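/-
Copyright: the b2b-balaban cell (near-miss cell 7), T⁴-continuum fan-out, lineage t4-ne7b-p1 (node U5c COUNT member).
Released under the licence of the surrounding project.
-/
import Summits.QuantumFields.BalabanUV.T4Continuum.Support.CountSeamJunction

/-!
# The history socket: ONE Prop-structure whose fields are the (ID) leaves of the count route

Summits-side support leaf of the T⁴-continuum cell (rung (B)+1 on a FINITE torus only; NOT infinite volume, NOT the
mass gap, NOT the Clay statement; NOT a proof of the spine estimate NE7b).  Lineage `t4-ne7b-p1` (generation 21),
node U5c; the Lean face of `t4/b2b-balaban-t4-ne7b-p1/SKELETON-NE7b-P1.md` §2 H∕P (ROUND-2 skeleton-first).  [folklore]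
bookkeeping over the lineage's OWN typed carrier; nothing is quoted from print and nothing printed is asserted; no
`[cite:]` tag.

WHY.  The row's exit `CountThresholdUniform.relWeightBoundZ_of_irThreshold` (and its seam form
`CountSeamJunction.hybridNE7_of_irThresholdZ`) asks the (ID) supplier for FOUR intertwined data — a labelled price
`y K j z b Q` on ALL slots with the disjunction `hlabZ`, live families `str` of slots with `hinj`∕`hstr`, and the
dominations `hF`∕`hF′` — whose joint construction from a family of live genealogies is routine but easy to get wrong (the
price must be a FUNCTION OF THE SLOT, so distinct live structures need distinct slots; the family weight is a PRODUCT
over an image).  This leaf does that construction ONCE: the supplier (the 12-seat swarm of the skeleton's §4) fills the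
Prop-structure **`LiveHistories`** — per cutoff `K` and bad class `c`, a finite set `live K c` of genealogies and a
root cell `cellOf K G`, with the leaf-granular obligations (H2b) consistent ∧ well formed ∧ pending, (H2e) cells ∕ birth
kinds ∕ event tables ∕ an OLD member ∕ SLOT-INJECTIVITY ∕ class-injectivity, (P) the class price dominated by the
PRODUCT of the members' labelled shapes — and gets the exit's four binders, hence `RelWeightBound` (§3) and `HybridNE7`
(§3), by name.

WHAT.  §1 `slotOf`, `InLive`, `shapeZ` (the right-hand side of `hlabZ`), `structure LiveHistories`.  §2 the derived
binders: `yOf` (the labelled price: `shapeZ` of THE live structure carrying the slot, `0` on unoccupied slots —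
well defined by slot-injectivity), `yOf_slotOf`, `yOf_nonneg`, `hlabZ_of_live`, `strOf`, `hinj_of_live`,
`hstr_of_live`, `famWeight_strOf`, `hF_of_live`.  §3 **`relWeightBound_of_liveHistories`** and
**`hybridNE7_of_liveHistories`**: the exit ∕ the seam form with the four (ID) binders REPLACED by `LiveHistories`.
§4 Sanity: the witness of `CountWitness` read as a `LiveHistories` instance is not needed — instead the empty-class
instance (no bad class) is recorded, and the field list is exercised on it.

NOT DONE HERE.  `LiveHistories` is a SOCKET: inhabiting it for Bałaban's runs IS the reading (ID) G-ne7bp1g9-1 (leaves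
H1∕H2∕H3 of the skeleton) together with the price domination (P1∕P3, under R-GD-1); (B) enters through the two
`Regeneration` binders as before.  NE7b discharge: no date.

HONEST DEPENDENCY (cell): continuum YM on T⁴ ⇐ BetaPertH ∧ nine spine estimates (0/9 proved); BetaPertH ⇐ (D1) ∧ (D4)
∧ CAP+tail.  This file changes none of it.
-/

open Finset
open Literature.MathematicalPhysics.QuantumFieldTheory.Balaban1983to89
open T4PersistenceDictionary T4PersistentHistoryCount T4BankedInduction T4PrintedShapeBanking
open T4WeightBudget T4GlobalDenominator T4LiveClassFibration T4LiveStructureGas T4LiveGasToTerms T4RecordPriceSeam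
open T4PartnerMultiplicity T4IndicatorShell T4MatchingAssembly T4MatchingClosure T4MatchingClosureSocket
open Summit.QuantumFields.BalabanUV.T4Continuum.PlacementBatch
open Summit.QuantumFields.BalabanUV.T4Continuum.PlacementSkeleton
open Summit.QuantumFields.BalabanUV.T4Continuum.PartnerMultiplicityF
open Summit.QuantumFields.BalabanUV.T4Continuum.PartnerMultiplicityZ
open Summit.QuantumFields.BalabanUV.T4Continuum.Crowding
open Summit.QuantumFields.BalabanUV.T4Continuum.CountThresholdUniform
open Summit.QuantumFields.BalabanUV.T4Continuum.CountThresholdExit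
open Summit.QuantumFields.BalabanUV.T4Continuum.CountSeamJunction

namespace Summit.QuantumFields.BalabanUV.T4Continuum.HistorySocket

noncomputable section

/-! ## §1 Slots, membership, the labelled shape, and the socket -/

section Defs

variable {γ κ : Type*}

/-- **THE SLOT OF A GENEALOGY** at cutoff `K`: (root step, root cell, root event, record = events but the root).
[folklore] -/
def slotOf (cellOf : ℕ → Gen PEv → γ) (K : ℕ) (G : Gen PEv) : Slot γ PEv :=
  ⟨G.rootStep, cellOf K G, G.root, G.events.erase G.root⟩

/-- `G` is LIVE at cutoff `K`: a member of the live family of some bad class at some admissible source `t`.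
[folklore] -/
def InLive (l₀ : ℝ) (Bad' : ℕ → ℝ → Finset κ) (live : ℕ → κ → Finset (Gen PEv)) (K : ℕ) (G : Gen PEv) : Prop :=
  ∃ t : ℝ, |t| ≤ l₀ ∧ ∃ c ∈ Bad' K t, G ∈ live K c

/-- **THE LABELLED SHAPE** of a genealogy at cutoff `K` — the right-hand side of the exit's binder `hlabZ` verbatim:
zone-crowding factor × partner-position factor × raw price `e^{−credits}·e^{+lifeCost}`. [folklore] -/
def shapeZ (C : T4PrintedShapeBanking.Consts) (Kz p σ Λ' : ℝ) (R : ℕ → ℕ → ℕ) (g : ℕ → ℕ → ℝ) (K : ℕ)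
    (G : Gen PEv) : ℝ :=
  Kz ^ (merges G).card * (∏ e ∈ merges G, Crowding.Q (wcnt G) σ e.step ^ p) * Λ' ^ partnerAges PEv.step G *
    (Real.exp (-credits (credit C (g K)) G) * Real.exp (lifeCost (dictW (R K) C.n₁) (cost C K (R K)) G))

/-- the labelled shape is nonnegative (`Kz ≥ 1`, `σ ≥ 0`, `Λ′ ≥ 0`) [folklore] -/
theorem shapeZ_nonneg {C : T4PrintedShapeBanking.Consts} {Kz p σ Λ' : ℝ} (hKz : 1 ≤ Kz) (hσ : 0 ≤ σ) (hΛ : 0 ≤ Λ')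
    (R : ℕ → ℕ → ℕ) (g : ℕ → ℕ → ℝ) (K : ℕ) (G : Gen PEv) : 0 ≤ shapeZ C Kz p σ Λ' R g K G := by
  unfold shapeZ
  refine mul_nonneg (mul_nonneg (mul_nonneg (pow_nonneg (zero_le_one.trans hKz) _)
    (prod_nonneg fun e he => ?_)) (pow_nonneg hΛ _)) (by positivity)
  exact Real.rpow_nonneg (zero_le_one.trans (one_le_Qw_of_mem hσ he)) _

/-- **THE HISTORY SOCKET.**  Data: per cutoff `K` and class `c` the finite set `live K c` of LIVE GENEALOGIES of the
class and a root-cell map `cellOf K`.  Obligations (the (ID)∕(P) leaves of the count route, each for `K ≥ K₀` and `G`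
live at `K`): (H2b) `Consistent`, `WF`, pending; (H2e) root cell of the right age, root a birth kind of its slot, record
inside the event table, an OLD member in every bad class, SLOT-INJECTIVITY on the live genealogies of a cutoff,
CLASS-INJECTIVITY of `live K` on the bad classes; (P) the class price `F·Rf` (both runs) dominated by the PRODUCT of the
members' labelled shapes. [folklore] -/
structure LiveHistories (C : T4PrintedShapeBanking.Consts) (Kz p σ Λ' : ℝ) (l₀ : ℝ) (K₀ : ℕ) (R : ℕ → ℕ → ℕ)
    (g : ℕ → ℕ → ℝ) (Cell : ℕ → ℕ → Finset γ) (E B : ℕ → ℕ → Finset PEv) (jstar : ℕ → ℕ)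
    (Bad' : ℕ → ℝ → Finset κ) (F Rf F' Rf' : ℕ → κ → ℝ) (live : ℕ → κ → Finset (Gen PEv))
    (cellOf : ℕ → Gen PEv → γ) : Prop where
  /-- (H2b) live genealogies are consistent at their cutoff -/
  consistent : ∀ K G, K₀ ≤ K → InLive l₀ Bad' live K G → Consistent C K (R K) G
  /-- (H2b) … and well formed for the run's window table -/
  wf : ∀ K G, K₀ ≤ K → InLive l₀ Bad' live K G → G.WF (dictW (R K) C.n₁)
  /-- (H2b) … and pending at the cutoff -/
  pending : ∀ K G, K₀ ≤ K → InLive l₀ Bad' live K G → K < G.reach (dictW (R K) C.n₁)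
  /-- (H2e) the root cell is a cell of the root's age -/
  cell_mem : ∀ K G, K₀ ≤ K → InLive l₀ Bad' live K G → cellOf K G ∈ Cell K (K - G.rootStep)
  /-- (H2e) the root is a birth kind of its slot -/
  root_mem : ∀ K G, K₀ ≤ K → InLive l₀ Bad' live K G → G.root ∈ B K G.rootStep
  /-- (H2e) the record lies in the event table of its slot -/
  events_sub : ∀ K G, K₀ ≤ K → InLive l₀ Bad' live K G → G.events.erase G.root ⊆ E K G.rootStep
  /-- (H2e) every bad class has an OLD live member (born before the matching scale) -/
  old : ∀ K t, |t| ≤ l₀ → K₀ ≤ K → ∀ c ∈ Bad' K t, ∃ G ∈ live K c, G.rootStep < jstar K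
  /-- (H2e) distinct live genealogies of a cutoff occupy distinct slots -/
  slot_inj : ∀ K G G', K₀ ≤ K → InLive l₀ Bad' live K G → InLive l₀ Bad' live K G' →
    slotOf cellOf K G = slotOf cellOf K G' → G = G'
  /-- (H2e) distinct bad classes have distinct live families -/
  live_inj : ∀ K t, |t| ≤ l₀ → K₀ ≤ K → Set.InjOn (live K) (Bad' K t)
  /-- (P) run A: the class price is dominated by the product of the members' labelled shapes -/
  price : ∀ K t, |t| ≤ l₀ → K₀ ≤ K → ∀ c ∈ Bad' K t, F K c * Rf K c ≤ ∏ G ∈ live K c, shapeZ C Kz p σ Λ' R g K G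
  /-- (P) run A′: the same -/
  price' : ∀ K t, |t| ≤ l₀ → K₀ ≤ K → ∀ c ∈ Bad' K t, F' K c * Rf' K c ≤ ∏ G ∈ live K c, shapeZ C Kz p σ Λ' R g K G

end Defs

/-! ## §2 The four (ID) binders of the exit, DERIVED from the socket -/

section Derived

variable {γ κ : Type*} {C : T4PrintedShapeBanking.Consts} {Kz p σ Λ' l₀ : ℝ}
  {K₀ : ℕ} {R : ℕ → ℕ → ℕ} {g : ℕ → ℕ → ℝ} {Cell : ℕ → ℕ → Finset γ} {E B : ℕ → ℕ → Finset PEv} {jstar : ℕ → ℕ}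
  {Bad' : ℕ → ℝ → Finset κ} {F Rf F' Rf' : ℕ → κ → ℝ} {live : ℕ → κ → Finset (Gen PEv)}
  {cellOf : ℕ → Gen PEv → γ}

/-- **THE LABELLED PRICE**: on a slot occupied by a live genealogy, that genealogy's labelled shape; `0` elsewhere.
(Classical choice of the occupant; unique by `slot_inj`.) [folklore] -/
def yOf (C : T4PrintedShapeBanking.Consts) (Kz p σ Λ' l₀ : ℝ) (R : ℕ → ℕ → ℕ) (g : ℕ → ℕ → ℝ)
    (Bad' : ℕ → ℝ → Finset κ) (live : ℕ → κ → Finset (Gen PEv)) (cellOf : ℕ → Gen PEv → γ)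
    (K j : ℕ) (z : γ) (b : PEv) (Q : Finset PEv) : ℝ :=
  haveI := Classical.dec (∃ G, InLive l₀ Bad' live K G ∧ slotOf cellOf K G = ⟨j, z, b, Q⟩)
  if h : ∃ G, InLive l₀ Bad' live K G ∧ slotOf cellOf K G = ⟨j, z, b, Q⟩ then
    shapeZ C Kz p σ Λ' R g K (Classical.choose h) else 0

/-- the labelled price is nonnegative [folklore] -/
theorem yOf_nonneg (hKz : 1 ≤ Kz) (hσ : 0 ≤ σ) (hΛ : 0 ≤ Λ') (K j : ℕ) (z : γ) (b : PEv) (Q : Finset PEv) :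
    0 ≤ yOf C Kz p σ Λ' l₀ R g Bad' live cellOf K j z b Q := by
  unfold yOf; split_ifs
  · exact shapeZ_nonneg hKz hσ hΛ R g K _
  · exact le_rfl

/-- **THE PRICE ON AN OCCUPIED SLOT IS THE OCCUPANT'S SHAPE** (slot-injectivity makes the choice irrelevant). [folklore] -/
theorem yOf_slotOf (H : LiveHistories C Kz p σ Λ' l₀ K₀ R g Cell E B jstar Bad' F Rf F' Rf' live cellOf) {K : ℕ}
    (hK : K₀ ≤ K) {G : Gen PEv} (hG : InLive l₀ Bad' live K G) :
    yOf C Kz p σ Λ' l₀ R g Bad' live cellOf K G.rootStep (cellOf K G) G.root (G.events.erase G.root) =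
      shapeZ C Kz p σ Λ' R g K G := by
  have h : ∃ G', InLive l₀ Bad' live K G' ∧
      slotOf cellOf K G' = ⟨G.rootStep, cellOf K G, G.root, G.events.erase G.root⟩ := ⟨G, hG, rfl⟩
  unfold yOf
  rw [dif_pos h]
  have hspec := Classical.choose_spec h
  have heq : Classical.choose h = G := H.slot_inj K _ _ hK hspec.1 hG (by rw [hspec.2]; rfl)
  rw [heq]

/-- **`hlabZ` FROM THE SOCKET**: at every counted slot the labelled price is `0` or the shape of a consistent, well
formed, pending genealogy born at the slot's step, rooted at its kind, with its record — the occupant. [folklore] -/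
theorem hlabZ_of_live (H : LiveHistories C Kz p σ Λ' l₀ K₀ R g Cell E B jstar Bad' F Rf F' Rf' live cellOf)
    (K : ℕ) (hK : K₀ ≤ K) (j : ℕ) (_hj : j ≤ K) (z : γ) (_hz : z ∈ Cell K (K - j)) (b : PEv) (_hb : b ∈ B K j)
    (Q : Finset PEv) (_hQ : Q ∈ records (dictW (R K) C.n₁) j K (E K j) b) :
    yOf C Kz p σ Λ' l₀ R g Bad' live cellOf K j z b Q ≤ 0 ∨
      ∃ G : Gen PEv, Consistent C K (R K) G ∧ G.WF (dictW (R K) C.n₁) ∧ G.rootStep = j ∧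
        K < G.reach (dictW (R K) C.n₁) ∧ G.root = b ∧ G.events.erase G.root = Q ∧
        yOf C Kz p σ Λ' l₀ R g Bad' live cellOf K j z b Q ≤
          Kz ^ (merges G).card * (∏ e ∈ merges G, Crowding.Q (wcnt G) σ e.step ^ p) *
            Λ' ^ partnerAges PEv.step G * (Real.exp (-credits (credit C (g K)) G) *
              Real.exp (lifeCost (dictW (R K) C.n₁) (cost C K (R K)) G)) := by
  by_cases h : ∃ G, InLive l₀ Bad' live K G ∧ slotOf cellOf K G = ⟨j, z, b, Q⟩
  · obtain ⟨G, hG, hs⟩ := h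
    simp only [slotOf, Sigma.mk.inj_iff, heq_eq_eq] at hs
    obtain ⟨rfl, rfl, rfl, rfl⟩ := hs
    refine Or.inr ⟨G, H.consistent K G hK hG, H.wf K G hK hG, rfl, H.pending K G hK hG, rfl, rfl, ?_⟩
    rw [yOf_slotOf H hK hG]; exact le_of_eq rfl
  · left
    unfold yOf; rw [dif_neg h]

/-- the slot map is injective on a live family [folklore] -/
theorem slotOf_injOn (H : LiveHistories C Kz p σ Λ' l₀ K₀ R g Cell E B jstar Bad' F Rf F' Rf' live cellOf) {K : ℕ}
    (hK : K₀ ≤ K) {t : ℝ} (ht : |t| ≤ l₀) {c : κ} (hc : c ∈ Bad' K t) :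
    Set.InjOn (slotOf cellOf K) (live K c : Set (Gen PEv)) := fun G hG G' hG' h =>
  H.slot_inj K G G' hK ⟨t, ht, c, hc, hG⟩ ⟨t, ht, c, hc, hG'⟩ h

variable [DecidableEq γ]

/-- **THE LIVE FAMILIES OF SLOTS**: the slots of the class's live genealogies. [folklore] -/
def strOf (live : ℕ → κ → Finset (Gen PEv)) (cellOf : ℕ → Gen PEv → γ) (K : ℕ) (c : κ) : Finset (Slot γ PEv) :=
  (live K c).image (slotOf cellOf K)

/-- **`hinj` FROM THE SOCKET**: distinct bad classes have distinct slot families (slot-injectivity transports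
class-injectivity through the image). [folklore] -/
theorem hinj_of_live (H : LiveHistories C Kz p σ Λ' l₀ K₀ R g Cell E B jstar Bad' F Rf F' Rf' live cellOf)
    (K : ℕ) (t : ℝ) (ht : |t| ≤ l₀) (hK : K₀ ≤ K) : Set.InjOn (strOf live cellOf K) (Bad' K t) := by
  intro c hc c' hc' h
  apply H.live_inj K t ht hK hc hc'
  have key : ∀ {d d' : κ}, d ∈ Bad' K t → d' ∈ Bad' K t → strOf live cellOf K d = strOf live cellOf K d' →
      live K d ⊆ live K d' := by
    intro d d' hd hd' hdd G hG
    have hmem : slotOf cellOf K G ∈ strOf live cellOf K d' := by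
      rw [← hdd]; exact mem_image_of_mem _ hG
    obtain ⟨G', hG', hs⟩ := mem_image.1 hmem
    have := H.slot_inj K G' G hK ⟨t, ht, d', hd', hG'⟩ ⟨t, ht, d, hd, hG⟩ hs
    rw [← this]; exact hG'
  exact Subset.antisymm (key hc hc' h) (key hc' hc h.symm)

/-- **`hstr` FROM THE SOCKET**: the slot family of a bad class consists of LIVE slots and contains an OLD one.
[folklore] -/
theorem hstr_of_live (H : LiveHistories C Kz p σ Λ' l₀ K₀ R g Cell E B jstar Bad' F Rf F' Rf' live cellOf)
    (K : ℕ) (t : ℝ) (ht : |t| ≤ l₀) (hK : K₀ ≤ K) :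
    ∀ c ∈ Bad' K t, strOf live cellOf K c ⊆ liveSlots Cell (dictW (R K) C.n₁) E B K ∧
      ∃ o ∈ oldSlots Cell (dictW (R K) C.n₁) E B jstar K, o ∈ strOf live cellOf K c := by
  intro c hc
  have hslot : ∀ G ∈ live K c, G.rootStep ≤ K ∧
      G.events.erase G.root ∈ records (dictW (R K) C.n₁) G.rootStep K (E K G.rootStep) G.root := by
    intro G hG
    have hin : InLive l₀ Bad' live K G := ⟨t, ht, c, hc, hG⟩
    have hcG := H.consistent K G hK hin
    refine ⟨?_, Gen.mem_records (H.wf K G hK hin) (H.pending K G hK hin) (H.events_sub K G hK hin)⟩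
    have h1 := (Consistent.root_spec hcG).2
    have h2 := step_le_of_consistent hcG G.root G.root_mem
    omega
  refine ⟨fun s hs => ?_, ?_⟩
  · obtain ⟨G, hG, rfl⟩ := mem_image.1 hs
    have hin : InLive l₀ Bad' live K G := ⟨t, ht, c, hc, hG⟩
    obtain ⟨hle, hrec⟩ := hslot G hG
    simp only [liveSlots, slotOf, mem_sigma, mem_range]
    exact ⟨Nat.lt_succ_of_le hle, H.cell_mem K G hK hin, H.root_mem K G hK hin, hrec⟩
  · obtain ⟨G, hG, hold⟩ := H.old K t ht hK c hc
    have hin : InLive l₀ Bad' live K G := ⟨t, ht, c, hc, hG⟩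
    obtain ⟨-, hrec⟩ := hslot G hG
    refine ⟨slotOf cellOf K G, ?_, mem_image_of_mem _ hG⟩
    simp only [oldSlots, slotOf, mem_sigma, mem_range]
    exact ⟨hold, H.cell_mem K G hK hin, H.root_mem K G hK hin, hrec⟩

/-- **THE FAMILY WEIGHT OF A SLOT FAMILY IS THE PRODUCT OF THE MEMBERS' SHAPES** (image of an injective map; the price
on each occupied slot is the occupant's shape). [folklore] -/
theorem famWeight_strOf (H : LiveHistories C Kz p σ Λ' l₀ K₀ R g Cell E B jstar Bad' F Rf F' Rf' live cellOf)
    {K : ℕ} (hK : K₀ ≤ K) {t : ℝ} (ht : |t| ≤ l₀) {c : κ} (hc : c ∈ Bad' K t) :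
    famWeight (slotPrice (yOf C Kz p σ Λ' l₀ R g Bad' live cellOf K)) (strOf live cellOf K c) =
      ∏ G ∈ live K c, shapeZ C Kz p σ Λ' R g K G := by
  rw [famWeight, strOf, prod_image (slotOf_injOn H hK ht hc)]
  refine prod_congr rfl fun G hG => ?_
  simp only [slotOf, slotPrice]
  exact yOf_slotOf H hK ⟨t, ht, c, hc, hG⟩

/-- **`hF` ∕ `hF′` FROM THE SOCKET.** [folklore] -/
theorem hF_of_live (H : LiveHistories C Kz p σ Λ' l₀ K₀ R g Cell E B jstar Bad' F Rf F' Rf' live cellOf)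
    (K : ℕ) (t : ℝ) (ht : |t| ≤ l₀) (hK : K₀ ≤ K) :
    ∀ c ∈ Bad' K t, F K c * Rf K c ≤
      famWeight (slotPrice (yOf C Kz p σ Λ' l₀ R g Bad' live cellOf K)) (strOf live cellOf K c) :=
  fun c hc => by rw [famWeight_strOf H hK ht hc]; exact H.price K t ht hK c hc

/-- … [folklore] -/
theorem hF'_of_live (H : LiveHistories C Kz p σ Λ' l₀ K₀ R g Cell E B jstar Bad' F Rf F' Rf' live cellOf)
    (K : ℕ) (t : ℝ) (ht : |t| ≤ l₀) (hK : K₀ ≤ K) :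
    ∀ c ∈ Bad' K t, F' K c * Rf' K c ≤
      famWeight (slotPrice (yOf C Kz p σ Λ' l₀ R g Bad' live cellOf K)) (strOf live cellOf K c) :=
  fun c hc => by rw [famWeight_strOf H hK ht hc]; exact H.price' K t ht hK c hc

end Derived

/-! ## §3 The exit and the seam form over the socket -/

section Exit

variable {γ κ ι : Type*} [DecidableEq γ] [DecidableEq κ] [DecidableEq ι] {l₀ vol : ℝ} {K₀ : ℕ} {π : ℕ → ι → κ}
  {T : ℕ → Finset ι} {A A' shA shB : ℕ → ℝ → ι → ℝ} {Bad' : ℕ → ℝ → Finset κ} {dead dead' : ℕ → ℝ → ι → ℝ}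
  {F Rf F' Rf' : ℕ → κ → ℝ} {nlow nup mlow mup : ℕ → ℝ → ℝ} {Cn : ℝ}
  {Cc Rr CcRec RrRec : ℕ → ℝ → ι → ℝ} {ν u s₂ c₀ r s Wsh : ℕ → ℝ}

omit [DecidableEq ι] in
/-- **NE7b's COUNT EXIT OVER THE HISTORY SOCKET.**  `CountThresholdUniform.relWeightBoundZ_of_irThreshold` with its four
(ID) binders (`y`∕`hy0`∕`hlabZ`, `str`∕`hinj`∕`hstr`, `hF`, `hF′`) REPLACED by ONE `LiveHistories` hypothesis; every
other binder verbatim (typed flow at the NAMED threshold, cells, tables, matching scale, budgets, rates, the two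
`Regeneration` runs).  Conclusion unchanged. [folklore] -/
theorem relWeightBound_of_liveHistories {C : T4PrintedShapeBanking.Consts} {L rr : ℕ} {β₀ : ℝ}
    (h : ThresholdOK C L rr β₀)
    {Kz p σ ε θ : ℝ} (hKz : 1 ≤ Kz) (hp : 0 ≤ p) (h0 : 0 < σ) (h1 : σ < 1) (hε : 0 < ε) (hθ : 0 < θ)
    (Cell : ℕ → ℕ → Finset γ) {V Λ : ℝ} (hV : 0 ≤ V) (hΛ : 0 < Λ)
    (hcell : ∀ K a, ((Cell K a).card : ℝ) ≤ V * Λ ^ a) (E Bk : ℕ → ℕ → Finset PEv)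
    (hE : ∀ K j, ∀ e ∈ E K j, PEv.step e ∈ Ioc j K) (jstar : ℕ → ℕ) (hj : ∀ K, jstar K ≤ K) {c : ℝ} (hc : 0 < c)
    (hfrac : ∀ K : ℕ, c * K ≤ ((K - jstar K : ℕ) : ℝ))
    (hA : Regeneration l₀ π T A Bad' dead F Rf nlow nup Cn K₀)
    (hA' : Regeneration l₀ π T A' Bad' dead' F' Rf' mlow mup Cn K₀) (hCn : 0 ≤ Cn)
    (R : ℕ → ℕ → ℕ) (g : ℕ → ℕ → ℝ) (β' : ℕ → ℝ)
    (h27 : ∀ K, K₀ ≤ K → B14.FlowIneq27 (g K) (β' K) β₀ C.p₀ K)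
    (h29 : ∀ K, K₀ ≤ K → B14FlowStep.FlowIneq29 (R K) (g K) L (β' K) β₀ K)
    (hR : ∀ K, K₀ ≤ K → ∀ s, s ≤ K → B14.IsRj L rr (g K s) (R K s))
    (hx1 : ∀ K, K₀ ≤ K → ∀ s, s ≤ K → 1 ≤ Real.log ((g K s) ^ 2)⁻¹)
    (hir : ∀ K, K₀ ≤ K → irThresholdZ C Kz p σ ε θ L rr β₀ ≤ Real.log ((g K K) ^ 2)⁻¹)
    {ρbar ηbar : ℝ} (hρbar : ∀ K j, ∑ b ∈ Bk K j, rho C (g K) b ≤ ρbar)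
    (hηbar : ∀ K j, ∀ t ∈ Ioc j K, ∑ e ∈ E K j with PEv.step e = t, eta C e ≤ ηbar)
    (hrate : Λ * Real.exp (ηbar - C.κ₁) < 1) {Λ' : ℝ} (hΛ0 : 0 ≤ Λ') (hΛ1 : Λ' * Real.exp ε * Real.exp (-C.κ₁) ≤ 1)
    {live : ℕ → κ → Finset (Gen PEv)} {cellOf : ℕ → Gen PEv → γ}
    (H : LiveHistories C Kz p σ Λ' l₀ K₀ R g Cell E Bk jstar Bad' F Rf F' Rf' live cellOf) :
    ∃ K₁, K₀ ≤ K₁ ∧ RelWeightBound l₀ T A A' (fun K t => if K₁ ≤ K then badOfClass π T Bad' K t else ∅)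
      (Set.indicator {K | K₁ ≤ K} (fun K => Cn * recordsBudget ρbar C.κ₁ V Λ ηbar jstar K)) :=
  relWeightBoundZ_of_irThreshold h hKz hp h0 h1 hε hθ Cell hV hΛ hcell E Bk hE jstar hj hc hfrac hA hA' hCn R g β'
    h27 h29 hR hx1 hir hρbar hηbar hrate hΛ0 hΛ1 (yOf C Kz p σ Λ' l₀ R g Bad' live cellOf)
    (fun K j _ z _ b _ Q _ => yOf_nonneg hKz h0.le hΛ0 K j z b Q) (hlabZ_of_live H) (strOf live cellOf)
    (hinj_of_live H) (hstr_of_live H) (hF_of_live H) (hF'_of_live H)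

/-- **… AND INTO THE SEAM.**  `CountSeamJunction.hybridNE7_of_irThresholdZ` over the history socket: the census of what
the node-U5 assembly still displays is `LiveHistories` (the reading (ID) + the price domination), the typed flow at the
named threshold (⇐ BetaPertH), the two `Regeneration` runs (⇐ (B) via `T4StabilitySocket` + resummation), NE7c's socket,
NE7's core budget, four summable rates. [folklore] -/
theorem hybridNE7_of_liveHistories {C : T4PrintedShapeBanking.Consts} {L rr : ℕ} {β₀ : ℝ}
    (h : ThresholdOK C L rr β₀)
    {Kz p σ ε θ : ℝ} (hKz : 1 ≤ Kz) (hp : 0 ≤ p) (h0 : 0 < σ) (h1 : σ < 1) (hε : 0 < ε) (hθ : 0 < θ)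
    (Cell : ℕ → ℕ → Finset γ) {V Λ : ℝ} (hV : 0 ≤ V) (hΛ : 0 < Λ)
    (hcell : ∀ K a, ((Cell K a).card : ℝ) ≤ V * Λ ^ a) (E Bk : ℕ → ℕ → Finset PEv)
    (hE : ∀ K j, ∀ e ∈ E K j, PEv.step e ∈ Ioc j K) (jstar : ℕ → ℕ) (hj : ∀ K, jstar K ≤ K) {c : ℝ} (hc : 0 < c)
    (hfrac : ∀ K : ℕ, c * K ≤ ((K - jstar K : ℕ) : ℝ))
    (hA : Regeneration l₀ π T A Bad' dead F Rf nlow nup Cn K₀)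
    (hA' : Regeneration l₀ π T A' Bad' dead' F' Rf' mlow mup Cn K₀) (hCn : 0 ≤ Cn)
    (R : ℕ → ℕ → ℕ) (g : ℕ → ℕ → ℝ) (β' : ℕ → ℝ)
    (h27 : ∀ K, K₀ ≤ K → B14.FlowIneq27 (g K) (β' K) β₀ C.p₀ K)
    (h29 : ∀ K, K₀ ≤ K → B14FlowStep.FlowIneq29 (R K) (g K) L (β' K) β₀ K)
    (hR : ∀ K, K₀ ≤ K → ∀ s, s ≤ K → B14.IsRj L rr (g K s) (R K s))
    (hx1 : ∀ K, K₀ ≤ K → ∀ s, s ≤ K → 1 ≤ Real.log ((g K s) ^ 2)⁻¹)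
    (hir : ∀ K, K₀ ≤ K → irThresholdZ C Kz p σ ε θ L rr β₀ ≤ Real.log ((g K K) ^ 2)⁻¹)
    {ρbar ηbar : ℝ} (hρbar : ∀ K j, ∑ b ∈ Bk K j, rho C (g K) b ≤ ρbar)
    (hηbar : ∀ K j, ∀ t ∈ Ioc j K, ∑ e ∈ E K j with PEv.step e = t, eta C e ≤ ηbar)
    (hrate : Λ * Real.exp (ηbar - C.κ₁) < 1) {Λ' : ℝ} (hΛ0 : 0 ≤ Λ') (hΛ1 : Λ' * Real.exp ε * Real.exp (-C.κ₁) ≤ 1)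
    {live : ℕ → κ → Finset (Gen PEv)} {cellOf : ℕ → Gen PEv → γ}
    (H : LiveHistories C Kz p σ Λ' l₀ K₀ R g Cell E Bk jstar Bad' F Rf F' Rf' live cellOf)
    (hSh : ShellWeightBound l₀ T A A' shA shB Wsh)
    (hTB : ReindexedBudget l₀ vol T (fun K t τ => A K t τ - shA K t τ) (fun K t τ => A' K t τ - shB K t τ)
      (badOfClass π T Bad') Cc Rr CcRec RrRec ν u s₂ c₀ r s)
    (hr : Summable r) (hu : Summable u) (hs : Summable s) (hs₂ : Summable s₂) :
    ∃ K₁ K₂, K₀ ≤ K₁ ∧ HybridNE7 l₀ vol (fun K => T (K₁ + (K₂ + K))) (fun K => A (K₁ + (K₂ + K)))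
      (fun K => A' (K₁ + (K₂ + K))) (fun K => badOfClass π T Bad' (K₁ + (K₂ + K)))
      (fun K => Cn * recordsBudget ρbar C.κ₁ V Λ ηbar jstar (K₁ + (K₂ + K)))
      (fun K => shA (K₁ + (K₂ + K))) (fun K => shB (K₁ + (K₂ + K))) (fun K => Wsh (K₁ + (K₂ + K)))
      (fun K => (r (K₁ + (K₂ + K)) + u (K₁ + (K₂ + K))) + (s (K₁ + (K₂ + K)) + s₂ (K₁ + (K₂ + K)))) :=
  hybridNE7_of_eventually
    (relWeightBound_of_liveHistories h hKz hp h0 h1 hε hθ Cell hV hΛ hcell E Bk hE jstar hj hc hfrac hA hA' hCn R g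
      β' h27 h29 hR hx1 hir hρbar hηbar hrate hΛ0 hΛ1 H)
    hSh hTB hr hu hs hs₂

end Exit

/-! ## §4 Sanity: the socket with no bad class -/

namespace Sanity

/-- With EMPTY bad classes every field of `LiveHistories` holds for the empty live families (vacuously or by empty
products ≥ `F·Rf` being unasked): the socket is inhabited — its content is what the (ID) supplier puts into `live`.
[folklore] -/
example (C : T4PrintedShapeBanking.Consts) (Kz p σ Λ' l₀ : ℝ) (K₀ : ℕ) (R : ℕ → ℕ → ℕ) (g : ℕ → ℕ → ℝ)
    (Cell : ℕ → ℕ → Finset ℕ) (E B : ℕ → ℕ → Finset PEv) (jstar : ℕ → ℕ) (F Rf F' Rf' : ℕ → Unit → ℝ) :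
    LiveHistories C Kz p σ Λ' l₀ K₀ R g Cell E B jstar (fun _ _ => (∅ : Finset Unit)) F Rf F' Rf'
      (fun _ _ => (∅ : Finset (Gen PEv))) (fun _ _ => (0 : ℕ)) where
  consistent K G _ h := by obtain ⟨t, -, c, hc, -⟩ := h; simp at hc
  wf K G _ h := by obtain ⟨t, -, c, hc, -⟩ := h; simp at hc
  pending K G _ h := by obtain ⟨t, -, c, hc, -⟩ := h; simp at hc
  cell_mem K G _ h := by obtain ⟨t, -, c, hc, -⟩ := h; simp at hc
  root_mem K G _ h := by obtain ⟨t, -, c, hc, -⟩ := h; simp at hc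
  events_sub K G _ h := by obtain ⟨t, -, c, hc, -⟩ := h; simp at hc
  old K t _ _ c hc := by simp at hc
  slot_inj K G G' _ h := by obtain ⟨t, -, c, hc, -⟩ := h; simp at hc
  live_inj K t _ _ := by simp
  price K t _ _ c hc := by simp at hc
  price' K t _ _ c hc := by simp at hc

end Sanity

end

end Summit.QuantumFields.BalabanUV.T4Continuum.HistorySocket
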